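import Summits.CriticalPhenomena.PercolationContinuityZ3.Theorems.PercNearOneGluingNoHeavyLowerTailStarSetOmegaCliques
import HarnessLib

/-!
# `NoHeavyLowerTail` (stmt-CriticalPhenomena-4575) — derived facts of the residual units (U1-PROOF.md §§6–7; blueprint §G4)

Support file (prover `prim-gen-swap` gen 15; `--supports stmt-CriticalPhenomena-4575`).  No definitions, no named facts, no sorries.

From the data of a residual unit `u = (S, X)` (`StarSet.residual_unit_data`: first open forest class `Jf u`, hub ports `ef u ∈ Jf u`,
`ēf u ∉ Jf u`, trichotomy R1 / R2-C / R2-I, non-regularity) and a chosen non-inert rider `ρf u`, this file derives the facts the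
residual ledger uses: the hub is the only class through both its ports; off R1 the partner `Jf u` avoids `r` and `dom X ē ∋ r`; on R1
`Jf u = I₀` is the leaf class, `e = q₀ = P I₀`, `dom X ē` is cold, and `dom X e` is cold unless it is `I₀`; a non-inert rider of an R1
unit passes through `ē` and not through `q₀`; for a bundle unit of type R2, `dom X ē = I₀`, `ē = q₀` and the other port is `e`; and
a dominator of the hub through `q₀` that passes through `r` is `I₀`.

* `StarSet.residual_unit_facts`.
-/

namespace Summit.CriticalPhenomena.PercolationContinuityZ3.Theorems

open Finset
open scoped BigOperators Classical

namespace StarSet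

variable {ι V : Type*} [LinearOrder ι] [DecidableEq V]

/-- **Derived facts of the residual units.**  See the file header. -/
theorem residual_unit_facts (P P' : ι → V) (hPP' : ∀ X, P X ≠ P' X)
    (hinj : Function.Injective fun X => (s(P X, P' X) : Sym2 V)) (r : V) (F : Finset ι)
    (dom : ι → V → ι)
    (hdom : ∀ X ∉ F, ∀ d, (P X = d ∨ P' X = d) →
      dom X d ∈ F ∧ (P (dom X d) = d ∨ P' (dom X d) = d) ∧
        (∀ u, (P (dom X d) = u ∨ P' (dom X d) = u) → (P X = u ∨ P' X = u) → u = d))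
    (I₀ : ι) (hleaf : ∀ I ∈ F, P' I = r → I = I₀) (hI₀r : I₀ ∈ F → P' I₀ = r)
    (U : Finset (Finset ι × ι)) (Jf : Finset ι × ι → ι) (ef ēf : Finset ι × ι → V) (ρf : Finset ι × ι → ι)
    (hdata : (∀ u ∈ U, u.2 ∈ u.1 ∧ u.2 ∉ F ∧ (P u.2 ≠ r ∧ P' u.2 ≠ r) ∧
      (∀ Y ∈ u.1, P Y = P u.2 ∨ P Y = P' u.2 ∨ P' Y = P u.2 ∨ P' Y = P' u.2) ∧
      ¬ ((∀ I ∈ F, I ∉ u.1) ∨ ∃ a ∈ F, P a = r ∧ a ∈ u.1 ∧ ∀ b ∈ F, b < a → b ∉ u.1) ∧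
      Jf u ∈ u.1 ∧ Jf u ∈ F ∧ (∀ I ∈ u.1, I ∈ F → Jf u ≤ I) ∧ P (Jf u) ≠ r ∧
      ((P u.2 = ef u ∧ P' u.2 = ēf u) ∨ (P u.2 = ēf u ∧ P' u.2 = ef u)) ∧ (P (Jf u) = ef u ∨ P' (Jf u) = ef u) ∧
      ¬ (P (Jf u) = ēf u ∨ P' (Jf u) = ēf u) ∧
      ((P (Jf u) = ef u ∧ P' (Jf u) = r ∧ P (dom u.2 (ēf u)) ≠ r ∧ P' (dom u.2 (ēf u)) ≠ r) ∨
       (P (Jf u) ≠ r ∧ P' (Jf u) ≠ r ∧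
        ((P (dom u.2 (ēf u)) = r ∧ P' (dom u.2 (ēf u)) = ēf u ∧ Jf u < dom u.2 (ēf u)) ∨
         (P (dom u.2 (ēf u)) = ēf u ∧ P' (dom u.2 (ēf u)) = r)))) ∧
      (∀ Y ∈ u.1, Y ≠ u.2 → (P Y ≠ r ∧ P' Y ≠ r) → ∀ p, (P u.2 = p ∨ P' u.2 = p) → (P Y ≠ p ∧ P' Y ≠ p) →
        (P (dom u.2 p) = r ∨ P' (dom u.2 p) = r))))
    (hρ : (∀ u ∈ U, (((u.1.erase u.2).erase (Jf u)).filter (fun K => (P K ≠ r ∧ P' K ≠ r) ∧ K ≠ dom u.2 (ēf u))).Nonempty → ρf u ∈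
        (((u.1.erase u.2).erase (Jf u)).filter (fun K => (P K ≠ r ∧ P' K ≠ r) ∧ K ≠ dom u.2 (ēf u))))) :
    ∀ u ∈ U,
      (P u.2 = ef u ∨ P' u.2 = ef u) ∧ (P u.2 = ēf u ∨ P' u.2 = ēf u) ∧ ef u ≠ ēf u ∧ ef u ≠ r ∧ ēf u ≠ r ∧
      (∀ K, (P K = ef u ∨ P' K = ef u) → (P K = ēf u ∨ P' K = ēf u) → K = u.2) ∧
      (dom u.2 (ēf u) ∈ F ∧ (P (dom u.2 (ēf u)) = ēf u ∨ P' (dom u.2 (ēf u)) = ēf u)) ∧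
      (dom u.2 (ef u) ∈ F ∧ (P (dom u.2 (ef u)) = ef u ∨ P' (dom u.2 (ef u)) = ef u)) ∧
      (¬ (P (Jf u) = ef u ∧ P' (Jf u) = r) → (P (Jf u) ≠ r ∧ P' (Jf u) ≠ r) ∧ (P (dom u.2 (ēf u)) = r ∨ P' (dom u.2 (ēf u)) = r) ∧ Jf u ≠ I₀) ∧
      ((P (Jf u) = ef u ∧ P' (Jf u) = r) → Jf u = I₀ ∧ P I₀ = ef u ∧ I₀ ∈ F ∧ P' I₀ = r ∧ I₀ ∈ u.1 ∧ (P u.2 = P I₀ ∨ P' u.2 = P I₀) ∧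
        (if P u.2 = P I₀ then P' u.2 else P u.2) = ēf u ∧ (P (dom u.2 (ēf u)) ≠ r ∧ P' (dom u.2 (ēf u)) ≠ r) ∧
        (dom u.2 (ef u) ≠ Jf u → P (dom u.2 (ef u)) ≠ r ∧ P' (dom u.2 (ef u)) ≠ r)) ∧
      ((((u.1.erase u.2).erase (Jf u)).filter (fun K => (P K ≠ r ∧ P' K ≠ r) ∧ K ≠ dom u.2 (ēf u))).Nonempty →
        ρf u ∈ u.1 ∧ ρf u ≠ u.2 ∧ ρf u ≠ Jf u ∧ (P (ρf u) ≠ r ∧ P' (ρf u) ≠ r) ∧ ρf u ≠ dom u.2 (ēf u) ∧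
        (P (ρf u) = P u.2 ∨ P (ρf u) = P' u.2 ∨ P' (ρf u) = P u.2 ∨ P' (ρf u) = P' u.2) ∧
        ((P (Jf u) = ef u ∧ P' (Jf u) = r) → ¬ (P (ρf u) = ef u ∨ P' (ρf u) = ef u) ∧ (P (ρf u) = ēf u ∨ P' (ρf u) = ēf u))) ∧
      ((¬ (P (Jf u) = ef u ∧ P' (Jf u) = r) ∧ P' (dom u.2 (ēf u)) = r ∧ Jf u = dom u.2 (ef u)) →
        dom u.2 (ēf u) = I₀ ∧ I₀ ∈ F ∧ P' I₀ = r ∧ P I₀ = ēf u ∧ (P u.2 = P I₀ ∨ P' u.2 = P I₀) ∧ (if P u.2 = P I₀ then P' u.2 else P u.2) = ef u) ∧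
      (∀ d, (P u.2 = d ∨ P' u.2 = d) → d = P I₀ → I₀ ∈ F → P' I₀ = r →
        (P (dom u.2 d) = r ∨ P' (dom u.2 d) = r) → dom u.2 d = I₀) := by
  intro u hu
  obtain ⟨hXS, hXF, hXr, hadj, -, hJS, hJF, -, -, hX, hJe, hJē, htri, hNR⟩ := hdata u hu
  have heX : P u.2 = ef u ∨ P' u.2 = ef u := by rcases hX with ⟨h, _⟩ | ⟨_, h⟩; exacts [Or.inl h, Or.inr h]
  have hēX : P u.2 = ēf u ∨ P' u.2 = ēf u := by rcases hX with ⟨_, h⟩ | ⟨h, _⟩; exacts [Or.inr h, Or.inl h]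
  have heē : ef u ≠ ēf u := by
    rcases hX with ⟨h1, h2⟩ | ⟨h1, h2⟩
    · rw [← h1, ← h2]; exact hPP' u.2
    · rw [← h1, ← h2]; exact (hPP' u.2).symm
  have hport_r : ∀ x, (P u.2 = x ∨ P' u.2 = x) → x ≠ r := by
    rintro x (h | h)
    · rw [← h]; exact hXr.1
    · rw [← h]; exact hXr.2
  have her : ef u ≠ r := hport_r _ heX
  have hēr : ēf u ≠ r := hport_r _ hēX
  -- a class through both ports of the hub is the hub
  have hboth : ∀ K, (P K = ef u ∨ P' K = ef u) → (P K = ēf u ∨ P' K = ēf u) → K = u.2 := by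
    intro K hKe hKē
    apply hinj; simp only
    rw [sym2_eq_of_mem_of_mem heē hKe hKē, sym2_eq_of_mem_of_mem heē heX hēX]
  obtain ⟨hDF, hDē, hDoth⟩ := hdom u.2 hXF (ēf u) hēX
  obtain ⟨hDeF, hDee, hDeoth⟩ := hdom u.2 hXF (ef u) heX
  -- a dominator of the hub through `q₀` that passes through `r` is the leaf class
  have hdomI : ∀ d, (P u.2 = d ∨ P' u.2 = d) → d = P I₀ → I₀ ∈ F → P' I₀ = r →
      (P (dom u.2 d) = r ∨ P' (dom u.2 d) = r) → dom u.2 d = I₀ := by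
    intro d hXd hdq hIF hIr hr
    obtain ⟨hdF, hdd, -⟩ := hdom u.2 hXF d hXd
    rcases hr with h | h
    · apply hinj; simp only
      have hd' : P' (dom u.2 d) = d := by
        rcases hdd with h' | h'
        · exact absurd (h'.symm.trans h) (by rw [hdq]; exact fun e => hPP' I₀ (e.trans hIr.symm))
        · exact h'
      rw [h, hd', hdq, hIr]; exact Sym2.eq_swap
    · exact hleaf _ hdF h
  -- off R1
  have hoff : ¬ (P (Jf u) = ef u ∧ P' (Jf u) = r) →
      (P (Jf u) ≠ r ∧ P' (Jf u) ≠ r) ∧ (P (dom u.2 (ēf u)) = r ∨ P' (dom u.2 (ēf u)) = r) ∧ Jf u ≠ I₀ := by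
    intro hn
    rcases htri with ⟨h1, h2, -⟩ | ⟨h1, h2, hD⟩
    · exact absurd ⟨h1, h2⟩ hn
    · refine ⟨⟨h1, h2⟩, ?_, fun h => h2 ?_⟩
      · rcases hD with ⟨h, -, -⟩ | ⟨-, h⟩; exacts [Or.inl h, Or.inr h]
      · have hIF : I₀ ∈ F := by rw [← h]; exact hJF
        rw [h]; exact hI₀r hIF
  -- on R1
  have hon : (P (Jf u) = ef u ∧ P' (Jf u) = r) → Jf u = I₀ ∧ P I₀ = ef u ∧ I₀ ∈ F ∧ P' I₀ = r ∧ I₀ ∈ u.1 ∧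
      (P u.2 = P I₀ ∨ P' u.2 = P I₀) ∧ (if P u.2 = P I₀ then P' u.2 else P u.2) = ēf u ∧
      (P (dom u.2 (ēf u)) ≠ r ∧ P' (dom u.2 (ēf u)) ≠ r) ∧
      (dom u.2 (ef u) ≠ Jf u → P (dom u.2 (ef u)) ≠ r ∧ P' (dom u.2 (ef u)) ≠ r) := by
    intro h1
    have hJI : Jf u = I₀ := hleaf _ hJF h1.2
    have heq : P I₀ = ef u := by rw [← hJI]; exact h1.1
    have hcold : P (dom u.2 (ēf u)) ≠ r ∧ P' (dom u.2 (ēf u)) ≠ r := by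
      rcases htri with ⟨-, -, hc1, hc2⟩ | ⟨-, h2, -⟩
      · exact ⟨hc1, hc2⟩
      · exact absurd h1.2 h2
    have hIF : I₀ ∈ F := by rw [← hJI]; exact hJF
    have hIr : P' I₀ = r := by rw [← hJI]; exact h1.2
    have hIS : I₀ ∈ u.1 := by rw [← hJI]; exact hJS
    have ha : (if P u.2 = P I₀ then P' u.2 else P u.2) = ēf u := by
      rw [heq]
      rcases hX with ⟨hx1, hx2⟩ | ⟨hx1, hx2⟩
      · rw [if_pos hx1, hx2]
      · rw [if_neg (by rw [hx1]; exact heē.symm), hx1]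
    refine ⟨hJI, heq, hIF, hIr, hIS, by rw [heq]; exact heX, ha, hcold, fun hDJ => ?_⟩
    by_contra hc
    rw [not_and_or, not_not, not_not] at hc
    exact hDJ ((hdomI (ef u) heX heq.symm hIF hIr hc).trans hJI.symm)
  -- the rider
  have hrid : (((u.1.erase u.2).erase (Jf u)).filter (fun K => (P K ≠ r ∧ P' K ≠ r) ∧ K ≠ dom u.2 (ēf u))).Nonempty →
      ρf u ∈ u.1 ∧ ρf u ≠ u.2 ∧ ρf u ≠ Jf u ∧ (P (ρf u) ≠ r ∧ P' (ρf u) ≠ r) ∧ ρf u ≠ dom u.2 (ēf u) ∧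
      (P (ρf u) = P u.2 ∨ P (ρf u) = P' u.2 ∨ P' (ρf u) = P u.2 ∨ P' (ρf u) = P' u.2) ∧
      ((P (Jf u) = ef u ∧ P' (Jf u) = r) → ¬ (P (ρf u) = ef u ∨ P' (ρf u) = ef u) ∧ (P (ρf u) = ēf u ∨ P' (ρf u) = ēf u)) := by
    intro hne
    have h := hρ u hu hne
    obtain ⟨h1, h2, h3⟩ := mem_filter.1 h
    obtain ⟨hρJ, h1'⟩ := mem_erase.1 h1
    obtain ⟨hρX, hρS⟩ := mem_erase.1 h1'
    have hρadj := hadj _ hρS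
    -- the rider passes through exactly one port of the hub
    have hone : (P (ρf u) = ef u ∨ P' (ρf u) = ef u) ∨ (P (ρf u) = ēf u ∨ P' (ρf u) = ēf u) := by
      rcases hX with ⟨hx1, hx2⟩ | ⟨hx1, hx2⟩ <;> rw [hx1, hx2] at hρadj
      · rcases hρadj with h | h | h | h
        exacts [Or.inl (Or.inl h), Or.inr (Or.inl h), Or.inl (Or.inr h), Or.inr (Or.inr h)]
      · rcases hρadj with h | h | h | h
        exacts [Or.inr (Or.inl h), Or.inl (Or.inl h), Or.inr (Or.inr h), Or.inl (Or.inr h)]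
    refine ⟨hρS, hρX, hρJ, h2, h3, hadj _ hρS, fun hR1 => ?_⟩
    have hcold := (hon hR1).2.2.2.2.2.2.2.1
    have hρe : ¬ (P (ρf u) = ef u ∨ P' (ρf u) = ef u) := by
      intro hρe
      have hρē : P (ρf u) ≠ ēf u ∧ P' (ρf u) ≠ ēf u := by
        constructor <;> intro h' <;> apply hρX
        · exact hboth _ hρe (Or.inl h')
        · exact hboth _ hρe (Or.inr h')
      rcases hNR (ρf u) hρS hρX h2 (ēf u) hēX hρē with h' | h'
      · exact hcold.1 h'
      · exact hcold.2 h'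
    exact ⟨hρe, hone.resolve_left hρe⟩
  -- R2 bundle units
  have hbundle : (¬ (P (Jf u) = ef u ∧ P' (Jf u) = r) ∧ P' (dom u.2 (ēf u)) = r ∧ Jf u = dom u.2 (ef u)) →
      dom u.2 (ēf u) = I₀ ∧ I₀ ∈ F ∧ P' I₀ = r ∧ P I₀ = ēf u ∧ (P u.2 = P I₀ ∨ P' u.2 = P I₀) ∧
      (if P u.2 = P I₀ then P' u.2 else P u.2) = ef u := by
    rintro ⟨-, hb1, -⟩
    have hDI : dom u.2 (ēf u) = I₀ := hleaf _ hDF hb1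
    have hIr : P' I₀ = r := by rw [← hDI]; exact hb1
    have hIF : I₀ ∈ F := by rw [← hDI]; exact hDF
    have heq : P I₀ = ēf u := by
      rw [← hDI]
      rcases hDē with h | h
      · exact h
      · exact absurd (h.symm.trans hb1) hēr
    have ha : (if P u.2 = P I₀ then P' u.2 else P u.2) = ef u := by
      rw [heq]
      rcases hX with ⟨hx1, hx2⟩ | ⟨hx1, hx2⟩
      · rw [if_neg (by rw [hx1]; exact heē), hx1]
      · rw [if_pos hx1, hx2]
    exact ⟨hDI, hIF, hIr, heq, by rw [heq]; exact hēX, ha⟩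
  exact ⟨heX, hēX, heē, her, hēr, hboth, ⟨hDF, hDē⟩, ⟨hDeF, hDee⟩, hoff, hon, hrid, hbundle, hdomI⟩

end StarSet

end Summit.CriticalPhenomena.PercolationContinuityZ3.Theorems
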